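import Literature.NumberTheory.EllipticCurves.BSDHeegnerPointsTorsionProofs
import Literature.NumberTheory.EllipticCurves.HuShuYin2019.SylvesterNineQuotientParametrization
import Summits.BirchSwinnertonDyer.BirchSwinnertonDyer.Theorems.SylvesterTwoHeegnerIndexLevelFixingOrbitFormW
import HarnessLib

/-!
# (W2-b) `stub_levelFixingSeven` — ORBIT FORMS on the classes `p ≡ 7, 16 (mod 27)`, I: the partners `Q_n^{AW}`,
# `Q_n^{A²W}` of Hu–Shu–Yin's level-`243` form of conductor `9pn` under the reflections `AW`, `A²W` of `S₃ = ⟨W, A⟩`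
# are level-`243` Heegner forms of the same discriminant (crux `UpperOffV0HSYPlus`, stmt-BirchSwinnertonDyer-19804)

Cell `bsd-cm`, seat `bsd-cm-k7t-w2b` g0.  Helper toward `stmt-BirchSwinnertonDyer-19804` (`--supports … --as helper`);
sequel of `…LevelFixingOrbitFormW.lean` (p748618, the W-class `p ≡ 25 (mod 27)`), which left «NOT HERE: the classes
`p ≡ 7, 16 (mod 27)` (partners `A^{±1}W·τ_n`, memo §4.4: primitive form = raw transform / 243 — a sequel)».  THEOREMS ONLY
(no definition, no named fact, no instance, no notation, no `sorry`).  Vocabulary: `heegnerForms`, `heegnerTau`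
(`HeegnerPoints.lean`), `HeegnerForm.compAdj a b c d F = F ∘ adj(a b; c d)` (`BSDHeegnerPointsTorsionProofs.lean`),
`hsyA = (28 1/3; 81 1)`, `frickeGL 243 = w₂₄₃` (`HuShuYin2019/SylvesterNineQuotientParametrization.lean`), HSY's form
`Q_n = (n²A, nB, C)`, `(A, B, C) = (81P₁, −9P₂, P₃)`, `P₁ = p²+4p+16`, `P₂ = 4p²+17p+72`, `P₃ = 4p²+18p+81`
(`sylvesterForm_mem_heegnerForms`).

CONTEXT (memo `W2B-RECIPROCITY-k7t-c2-g32.md` v2 §1 (1.3), §2 (b), §4.4; kernel certificate p748342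
`SylvesterTwoLevelFixingCert.levelFixing_shimura_certificate`).  The decomposition involution at `w = (√−3)` carries HSY's CM point
`x(τ_n) ∈ X₀(3⁵)` to `Φ(A^{i}W)·x(τ_n)`, `i = a(p)·n mod 3`, `a = 2, 1, 0` for `p ≡ 7, 16, 25 (mod 27)`.  In `GL₂(ℚ)`,
`A·w₂₄₃ = (81 −28; 243 −81)` and `A²·w₂₄₃ = (2349 −811; 6804 −2349)` are INTEGER matrices of determinant `243`
(`coe_hsyA_mul_frickeGL`, `coe_hsyA_sq_mul_frickeGL`), so the form with root `A^iW • τ_n` is the raw transform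
`Q_n ∘ adj(A^iW)` made primitive; its content is exactly `243` (for `p ≡ 1 (mod 3)`), giving the DISPLAYED partners

  `Q_n^{AW}  = (243(9n²P₁ − 3nP₂ + P₃), −9(168n²P₁ − 55nP₂ + 18P₃), 784n²(P₁/3) − 84nP₂ + 27P₃)`,
  `Q_n^{A²W} = (243(7569n²P₁ − 2436nP₂ + 784P₃), −9(141114n²P₁ − 45415nP₂ + 14616P₃), 657721n²(P₁/3) − 70557nP₂ + 22707P₃)`

(`smul_partnerAW_eq_compAdj`, `smul_partnerAsqW_eq_compAdj`: `243 · Q_n^{g} = Q_n ∘ adj g` coefficientwise).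

* §0 (generic, any form / integer matrix of positive determinant / scaling `λ`, `λ·Q′ = F ∘ adj g`): the Möbius action of an
  integer matrix read in `GL₂(ℚ)` (`coe_glCast_smul_of_coe_eq`), `λ²·disc Q′ = det²·disc F` (`sq_mul_disc_of_smul_eq_compAdj`),
  a common divisor of `Q′` divides `det²·(A, B, C)` (`dvd_det_sq_mul_of_smul_eq_compAdj`), `(F ∘ adj g).1 > 0`
  (`compAdj_fst_pos_of_det_pos`), and ★ `heegnerTau Q′ = g • heegnerTau F` (`heegnerTau_eq_glCast_smul_of_smul_eq_compAdj`,
  via the tree's `compAdj_eval` + `eq_coe_heegnerTau_of_isRoot`).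
* §1–§2 the two matrices and the two displayed partners; §3 ★ `partnerAW_mem_heegnerForms`, ★ `partnerAsqW_mem_heegnerForms`:
  both partners lie in `heegnerForms 243 ((9pn)²·(−3))` for `p ≡ 1 (mod 3)`, `n ≥ 1`, `3 ∤ n`, `gcd(n, C) = 1` (primitivity:
  a common prime divisor divides `243²·Q_n`, is not `3` because `C′ ≡ n²(P₁/3) ≢ 0 (mod 3)`, hence divides `Q_n` — impossible).

NOT HERE: residues, CM points, assembly (sequel `…LevelFixingOrbitFormA.lean`); the class identity `[Q′] = η*·[Q_n]`
(numerically `η* = [(243, 243pn, 61(pn)²)]`, 2-torsion, in all six classes); any Galois statement.  HONEST LABEL: no stub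
closed; nothing asserted on 19804; X12.CMAtTwo NOT proved; BSD is proved for no curve.

## References
* Y. Hu, J. Shu, H. Yin, *An explicit Gross–Zagier formula related to the Sylvester conjecture*, Trans. AMS 372 (2019) =
  arXiv:1708.05266, §2.1 (p. 5 L29: `W`, `A`, `S₃`), §2.2 (Thm 2.2–2.3: the reflections, case split mod 27), §4.1 (p. 10). [HuShuYin2019]
* B. H. Gross, *Heegner points on `X₀(N)`* (1984), §I.1 (forms `(A, B, C)` with `N ∣ A`, action of matrices). [Gross1984]
* B. Gross, W. Kohnen, D. Zagier, *Heegner points and derivatives of L-series II*, Math. Ann. 278 (1987), §I.1. [GrossKohnenZagier1987]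
* Tree: `HeegnerForm.compAdj` + API (`BSDHeegnerPointsTorsionProofs`); `sylvesterForm_mem_heegnerForms`; `sylvesterA_div_eq`,
  `three_not_dvd_sylvesterA_div` (p748618); `hsyA` (p749218).  `lean search 'compAdj.*243|hsyA.*heegnerTau'` → nothing before.
-/

set_option autoImplicit false
-- the Summit-side namespace `Summit.BirchSwinnertonDyer.BirchSwinnertonDyer.…` (summit = problem) is mandated by D-0017
set_option linter.dupNamespace false

noncomputable section

open scoped MatrixGroups

namespace Summit.BirchSwinnertonDyer.BirchSwinnertonDyer.Theorems.SylvesterTwoLevelFixingOrbitA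

open UpperHalfPlane Complex
open Literature.NumberTheory.EllipticCurves Literature.NumberTheory.EllipticCurves.HeegnerForm
  Literature.NumberTheory.EllipticCurves.HuShuYin2019 Literature.NumberTheory.EllipticCurves.ModularForms
  Summit.BirchSwinnertonDyer.BirchSwinnertonDyer.Theorems.SylvesterTwoLevelFixingOrbit

/-! ## §0 Integer matrices of positive determinant on positive definite forms: `Q′ = (F ∘ adj g)/λ` -/

/-- The Möbius action of `g ∈ GL₂(ℚ)` with integer matrix `(a b; c d)` of positive determinant, as a quotient:
`g • τ = (aτ + b)/(cτ + d)`. [folklore] -/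
theorem coe_glCast_smul_of_coe_eq {g : GL (Fin 2) ℚ} {a b c d : ℤ}
    (hg : ((g : GL (Fin 2) ℚ) : Matrix (Fin 2) (Fin 2) ℚ) = !![(a : ℚ), b; c, d]) (hdet : 0 < a * d - b * c)
    (τ : ℍ) : ((glCast g • τ : ℍ) : ℂ) = ((a : ℂ) * τ + b) / ((c : ℂ) * τ + d) := by
  have hval : ((glCast g : GL (Fin 2) ℝ) : Matrix (Fin 2) (Fin 2) ℝ) = !![(a : ℝ), b; c, d] := by
    ext i j
    fin_cases i <;> fin_cases j <;> simp [glCast, hg]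
  have hdet' : 0 < (glCast g).det.val := by
    rw [Matrix.GeneralLinearGroup.val_det_apply, hval, Matrix.det_fin_two_of]
    exact_mod_cast hdet
  rw [coe_smul_of_det_pos hdet', num, denom, hval]
  simp only [Matrix.of_apply, Matrix.cons_val', Matrix.cons_val_zero, Matrix.cons_val_one,
    Matrix.cons_val_fin_one]
  push_cast
  ring

/-- `λ²·disc Q′ = det(g)²·disc F` when `λ·Q′ = F ∘ adj g` coefficientwise (`disc_compAdj`). [folklore] -/
theorem sq_mul_disc_of_smul_eq_compAdj {F Q' : ℤ × ℤ × ℤ} {a b c d l : ℤ}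
    (h₁ : l * Q'.1 = (compAdj a b c d F).1) (h₂ : l * Q'.2.1 = (compAdj a b c d F).2.1)
    (h₃ : l * Q'.2.2 = (compAdj a b c d F).2.2) :
    l ^ 2 * (Q'.2.1 ^ 2 - 4 * Q'.1 * Q'.2.2) = (a * d - b * c) ^ 2 * (F.2.1 ^ 2 - 4 * F.1 * F.2.2) := by
  rw [← disc_compAdj a b c d F, ← h₁, ← h₂, ← h₃]
  ring

/-- A common divisor of the coefficients of `Q′` divides `det(g)²·A`, `det(g)²·B`, `det(g)²·C` when
`λ·Q′ = F ∘ adj g` (the identities `(F ∘ adj g)(g·v) = det(g)² F(v)` at the columns of `g` and polarised,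
`compAdj_eval_col₀`, `compAdj_eval_col₁`, `compAdj_eval_polar`). [folklore] -/
theorem dvd_det_sq_mul_of_smul_eq_compAdj {F Q' : ℤ × ℤ × ℤ} {a b c d l : ℤ}
    (h₁ : l * Q'.1 = (compAdj a b c d F).1) (h₂ : l * Q'.2.1 = (compAdj a b c d F).2.1)
    (h₃ : l * Q'.2.2 = (compAdj a b c d F).2.2) {q : ℤ} (hq₁ : q ∣ Q'.1) (hq₂ : q ∣ Q'.2.1)
    (hq₃ : q ∣ Q'.2.2) :
    q ∣ (a * d - b * c) ^ 2 * F.1 ∧ q ∣ (a * d - b * c) ^ 2 * F.2.1 ∧ q ∣ (a * d - b * c) ^ 2 * F.2.2 := by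
  obtain ⟨x₁, hx₁⟩ := hq₁
  obtain ⟨x₂, hx₂⟩ := hq₂
  obtain ⟨x₃, hx₃⟩ := hq₃
  refine ⟨⟨l * (x₁ * a ^ 2 + x₂ * a * c + x₃ * c ^ 2), ?_⟩,
    ⟨l * (2 * x₁ * a * b + x₂ * (a * d + b * c) + 2 * x₃ * c * d), ?_⟩, ⟨l * (x₁ * b ^ 2 + x₂ * b * d + x₃ * d ^ 2), ?_⟩⟩
  · rw [← compAdj_eval_col₀ a b c d F, ← h₁, ← h₂, ← h₃, hx₁, hx₂, hx₃]; ring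
  · rw [← compAdj_eval_polar a b c d F, ← h₁, ← h₂, ← h₃, hx₁, hx₂, hx₃]; ring
  · rw [← compAdj_eval_col₁ a b c d F, ← h₁, ← h₂, ← h₃, hx₁, hx₂, hx₃]; ring

/-- The `A`-coefficient of `F ∘ adj g` is positive for `F` positive definite and `det g > 0` (whether or not `c = 0`:
`4A·A₁ = (2Ad − Bc)² + (4AC − B²)c²`, and `c = d = 0` is excluded by `det g > 0`). [folklore] -/
theorem compAdj_fst_pos_of_det_pos {F : ℤ × ℤ × ℤ} (hA : 0 < F.1) (hF : F.2.1 ^ 2 - 4 * F.1 * F.2.2 < 0)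
    {a b c d : ℤ} (hdet : 0 < a * d - b * c) : 0 < (compAdj a b c d F).1 := by
  by_cases hc : c = 0
  · subst hc
    have hd : d ≠ 0 := by rintro rfl; simp at hdet
    have h0 : (compAdj a b 0 d F).1 = F.1 * d ^ 2 := by simp [compAdj_fst]
    rw [h0]
    positivity
  · exact compAdj_fst_pos hA hF hc a b d

/-- ★ **The CM point of `Q′ = (F ∘ adj g)/λ` is `g • τ_F`.**  For `F` positive definite (`A > 0`, `disc < 0`), an integer
matrix `g = (a b; c d)` with `det g > 0` (read in `GL₂(ℚ)`), `λ > 0`, and a triple `Q′` with `λ·Q′ = F ∘ adj g`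
coefficientwise: `heegnerTau Q′ = g • heegnerTau F` (`g • τ_F` is a root of `Q′` in `ℍ`, `compAdj_eval`; the root in `ℍ`
is unique, `eq_coe_heegnerTau_of_isRoot`). [cite: Gross1984, §I.1] -/
theorem heegnerTau_eq_glCast_smul_of_smul_eq_compAdj {F Q' : ℤ × ℤ × ℤ} (hA : 0 < F.1)
    (hF : F.2.1 ^ 2 - 4 * F.1 * F.2.2 < 0) {a b c d l : ℤ} (hdet : 0 < a * d - b * c) (hl : 0 < l)
    (h₁ : l * Q'.1 = (compAdj a b c d F).1) (h₂ : l * Q'.2.1 = (compAdj a b c d F).2.1)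
    (h₃ : l * Q'.2.2 = (compAdj a b c d F).2.2) {g : GL (Fin 2) ℚ}
    (hg : ((g : GL (Fin 2) ℚ) : Matrix (Fin 2) (Fin 2) ℚ) = !![(a : ℚ), b; c, d]) :
    heegnerTau Q' = glCast g • heegnerTau F := by
  -- `Q′` is positive definite
  have hA' : 0 < Q'.1 := by
    have h := compAdj_fst_pos_of_det_pos hA hF hdet
    rw [← h₁] at h
    exact pos_of_mul_pos_right (lt_of_lt_of_le h le_rfl) hl.le
  have hQ' : Q'.2.1 ^ 2 - 4 * Q'.1 * Q'.2.2 < 0 := by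
    have h := sq_mul_disc_of_smul_eq_compAdj h₁ h₂ h₃
    have hdet2 : 0 < (a * d - b * c) ^ 2 := by positivity
    have hl2 : 0 < l ^ 2 := by positivity
    have hneg : l ^ 2 * (Q'.2.1 ^ 2 - 4 * Q'.1 * Q'.2.2) < 0 := by
      rw [h]; exact mul_neg_of_pos_of_neg hdet2 hF
    by_contra hge
    push Not at hge
    exact absurd hneg (not_lt.mpr (mul_nonneg hl2.le hge))
  -- the root `τ_F` and the point `g • τ_F`
  set τ : ℍ := heegnerTau F with hτdef
  have hroot := heegnerTau_isRoot hA hF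
  rw [← hτdef] at hroot
  have hden : (c : ℂ) * (τ : ℂ) + d ≠ 0 := by
    intro h0
    have him := congrArg Complex.im h0
    simp only [add_im, mul_im, intCast_re, intCast_im, zero_mul, add_zero, zero_im,
      UpperHalfPlane.coe_im, UpperHalfPlane.coe_re] at him
    -- `c * im τ = 0` forces `c = 0`, and then `d = 0`, contradicting `det g > 0`
    have hc : c = 0 := by
      rcases mul_eq_zero.mp him with h | h
      · exact_mod_cast h
      · exact absurd h τ.im_pos.ne'
    subst hc
    have hd : (d : ℂ) = 0 := by simpa using h0
    have hd' : d = 0 := by exact_mod_cast hd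
    subst hd'
    simp at hdet
  have hz : ((glCast g • τ : ℍ) : ℂ) = ((a : ℂ) * τ + b) / ((c : ℂ) * τ + d) :=
    coe_glCast_smul_of_coe_eq hg hdet τ
  -- `λ · Q′(aτ+b, cτ+d) = (F ∘ adj g)(aτ+b, cτ+d) = det² · F(τ, 1) = 0`
  have key := compAdj_eval a b c d F (τ : ℂ)
  rw [hroot, mul_zero, ← h₁, ← h₂, ← h₃] at key
  push_cast at key
  have hl' : (l : ℂ) ≠ 0 := by exact_mod_cast hl.ne'
  have hnum : (Q'.1 : ℂ) * ((a : ℂ) * τ + b) ^ 2 + Q'.2.1 * ((a : ℂ) * τ + b) * ((c : ℂ) * τ + d) +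
      Q'.2.2 * ((c : ℂ) * τ + d) ^ 2 = 0 := by
    apply mul_left_cancel₀ hl'
    rw [mul_zero]
    linear_combination key
  apply UpperHalfPlane.ext
  symm
  refine eq_coe_heegnerTau_of_isRoot hA' hQ' (glCast g • τ).im_pos ?_
  rw [hz, div_eq_mul_inv]
  have hu : ((c : ℂ) * τ + d) * ((c : ℂ) * τ + d)⁻¹ = 1 := mul_inv_cancel₀ hden
  linear_combination ((c : ℂ) * τ + d)⁻¹ ^ 2 * hnum -
    ((Q'.2.1 : ℂ) * ((a : ℂ) * τ + b) * ((c : ℂ) * τ + d)⁻¹ + Q'.2.2 * (1 + ((c : ℂ) * τ + d) * ((c : ℂ) * τ + d)⁻¹)) * hu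


/-! ## §1 The two integer matrices `AW = (81 −28; 243 −81)`, `A²W = (2349 −811; 6804 −2349)` (det `243`) -/

/-- The matrix of `A·w₂₄₃ ∈ GL₂(ℚ)` (`A = hsyA = (28 1/3; 81 1)`, `w₂₄₃ = frickeGL 243 = (0 −1; 243 0)`) is the INTEGER
matrix `(81 −28; 243 −81)` of determinant `243` (memo (1.3)/§2 (f): `AW`, up to the sign `−1` which acts trivially on `ℍ`).
[cite: HuShuYin2019, §2.1 (p. 5 L29)] -/
theorem coe_hsyA_mul_frickeGL :
    ((hsyA * (frickeGL 243 : GL (Fin 2) ℚ) : GL (Fin 2) ℚ) : Matrix (Fin 2) (Fin 2) ℚ) =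
      !![((81 : ℤ) : ℚ), ((-28 : ℤ) : ℚ); ((243 : ℤ) : ℚ), ((-81 : ℤ) : ℚ)] := by
  ext i j
  fin_cases i <;> fin_cases j <;> norm_num [hsyA, Matrix.mul_apply, Fin.sum_univ_two]

/-- The matrix of `A²·w₂₄₃ ∈ GL₂(ℚ)` is the INTEGER matrix `(2349 −811; 6804 −2349)` of determinant `243` (memo §2 (f):
`A²W`, up to sign). [cite: HuShuYin2019, §2.1 (p. 5 L29)] -/
theorem coe_hsyA_sq_mul_frickeGL :
    ((hsyA ^ 2 * (frickeGL 243 : GL (Fin 2) ℚ) : GL (Fin 2) ℚ) : Matrix (Fin 2) (Fin 2) ℚ) =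
      !![((2349 : ℤ) : ℚ), ((-811 : ℤ) : ℚ); ((6804 : ℤ) : ℚ), ((-2349 : ℤ) : ℚ)] := by
  ext i j
  fin_cases i <;> fin_cases j <;> norm_num [hsyA, pow_succ, Matrix.mul_apply, Fin.sum_univ_two]

/-! ## §2 The partners `Q_n^{AW}`, `Q_n^{A²W}` = (raw transform)/243, as explicit polynomial triples -/

/-- **`243 · Q_n^{AW} = Q_n ∘ adj(AW)`**: the raw transform of Hu–Shu–Yin's form `Q_n = (n²A, nB, C)` of conductor `9pn` by
`AW = (81 −28; 243 −81)` has content `243` (for `p ≡ 1 (mod 3)`), and the quotient is the displayed polynomial triple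
`Q_n^{AW} = (243(9n²P₁ − 3nP₂ + P₃), −9(168n²P₁ − 55nP₂ + 18P₃), 784n²(P₁/3) − 84nP₂ + 27P₃)`,
`P₁ = p²+4p+16`, `P₂ = 4p²+17p+72`, `P₃ = 4p²+18p+81` (memo (W2-b) §4.4 «primitive form = raw transform / 243»).
[cite: HuShuYin2019, §2.2 (proof of Thm 2.2: the reflections of S₃), §4.1 (p. 10: τ)] -/
theorem smul_partnerAW_eq_compAdj {p : ℕ} (hp : p % 3 = 1) (n : ℕ) :
    (243 : ℤ) * (243 * (9 * (n : ℤ) ^ 2 * ((p : ℤ) ^ 2 + 4 * p + 16) - 3 * n * (4 * (p : ℤ) ^ 2 + 17 * p + 72) +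
        (4 * (p : ℤ) ^ 2 + 18 * p + 81))) =
      (compAdj 81 (-28) 243 (-81) ((n : ℤ) ^ 2 * (81 * ((p : ℤ) ^ 2 + 4 * p + 16)),
        (n : ℤ) * (-(9 * (4 * (p : ℤ) ^ 2 + 17 * p + 72))), 4 * (p : ℤ) ^ 2 + 18 * p + 81)).1 ∧
    (243 : ℤ) * (-(9 * (168 * (n : ℤ) ^ 2 * ((p : ℤ) ^ 2 + 4 * p + 16) - 55 * n * (4 * (p : ℤ) ^ 2 + 17 * p + 72) +
        18 * (4 * (p : ℤ) ^ 2 + 18 * p + 81)))) =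
      (compAdj 81 (-28) 243 (-81) ((n : ℤ) ^ 2 * (81 * ((p : ℤ) ^ 2 + 4 * p + 16)),
        (n : ℤ) * (-(9 * (4 * (p : ℤ) ^ 2 + 17 * p + 72))), 4 * (p : ℤ) ^ 2 + 18 * p + 81)).2.1 ∧
    (243 : ℤ) * (784 * (n : ℤ) ^ 2 * (((p : ℤ) ^ 2 + 4 * p + 16) / 3) - 84 * n * (4 * (p : ℤ) ^ 2 + 17 * p + 72) +
        27 * (4 * (p : ℤ) ^ 2 + 18 * p + 81)) =
      (compAdj 81 (-28) 243 (-81) ((n : ℤ) ^ 2 * (81 * ((p : ℤ) ^ 2 + 4 * p + 16)),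
        (n : ℤ) * (-(9 * (4 * (p : ℤ) ^ 2 + 17 * p + 72))), 4 * (p : ℤ) ^ 2 + 18 * p + 81)).2.2 := by
  have h3 := (sylvesterA_div_eq hp (n : ℤ)).2
  refine ⟨?_, ?_, ?_⟩
  · simp only [compAdj_fst]; ring
  · simp only [compAdj_snd_fst]; ring
  · simp only [compAdj_snd_snd]; linear_combination (63504 * (n : ℤ) ^ 2) * h3

/-- **`243 · Q_n^{A²W} = Q_n ∘ adj(A²W)`** for `A²W = (2349 −811; 6804 −2349)`, `p ≡ 1 (mod 3)`, with the displayed quotient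
`Q_n^{A²W} = (243(7569n²P₁ − 2436nP₂ + 784P₃), −9(141114n²P₁ − 45415nP₂ + 14616P₃), 657721n²(P₁/3) − 70557nP₂ + 22707P₃)`.
[cite: HuShuYin2019, §2.2 (proof of Thm 2.2), §4.1 (p. 10)] -/
theorem smul_partnerAsqW_eq_compAdj {p : ℕ} (hp : p % 3 = 1) (n : ℕ) :
    (243 : ℤ) * (243 * (7569 * (n : ℤ) ^ 2 * ((p : ℤ) ^ 2 + 4 * p + 16) - 2436 * n * (4 * (p : ℤ) ^ 2 + 17 * p + 72) +
        784 * (4 * (p : ℤ) ^ 2 + 18 * p + 81))) =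
      (compAdj 2349 (-811) 6804 (-2349) ((n : ℤ) ^ 2 * (81 * ((p : ℤ) ^ 2 + 4 * p + 16)),
        (n : ℤ) * (-(9 * (4 * (p : ℤ) ^ 2 + 17 * p + 72))), 4 * (p : ℤ) ^ 2 + 18 * p + 81)).1 ∧
    (243 : ℤ) * (-(9 * (141114 * (n : ℤ) ^ 2 * ((p : ℤ) ^ 2 + 4 * p + 16) -
        45415 * n * (4 * (p : ℤ) ^ 2 + 17 * p + 72) + 14616 * (4 * (p : ℤ) ^ 2 + 18 * p + 81)))) =
      (compAdj 2349 (-811) 6804 (-2349) ((n : ℤ) ^ 2 * (81 * ((p : ℤ) ^ 2 + 4 * p + 16)),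
        (n : ℤ) * (-(9 * (4 * (p : ℤ) ^ 2 + 17 * p + 72))), 4 * (p : ℤ) ^ 2 + 18 * p + 81)).2.1 ∧
    (243 : ℤ) * (657721 * (n : ℤ) ^ 2 * (((p : ℤ) ^ 2 + 4 * p + 16) / 3) - 70557 * n * (4 * (p : ℤ) ^ 2 + 17 * p + 72) +
        22707 * (4 * (p : ℤ) ^ 2 + 18 * p + 81)) =
      (compAdj 2349 (-811) 6804 (-2349) ((n : ℤ) ^ 2 * (81 * ((p : ℤ) ^ 2 + 4 * p + 16)),
        (n : ℤ) * (-(9 * (4 * (p : ℤ) ^ 2 + 17 * p + 72))), 4 * (p : ℤ) ^ 2 + 18 * p + 81)).2.2 := by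
  have h3 := (sylvesterA_div_eq hp (n : ℤ)).2
  refine ⟨?_, ?_, ?_⟩
  · simp only [compAdj_fst]; ring
  · simp only [compAdj_snd_fst]; ring
  · simp only [compAdj_snd_snd]; linear_combination (53275401 * (n : ℤ) ^ 2) * h3


/-! ## §3 Both partners are level-`243` Heegner forms of discriminant `(9pn)²·(−3)` -/

/-- Primitivity transfer for the Sylvester tower (private helper): if `243·Q′ = Q_n ∘ adj g` with `det g = 243` and
`3 ∤ C′`, then `Q′` is primitive — a common prime divisor `q` of `Q′` divides `243²·(n²A, nB, C)`
(`dvd_det_sq_mul_of_smul_eq_compAdj`); `q ≠ ±3` since `3 ∤ C′`, so `q` divides `n²A, nB, C`, contradicting the primitivity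
of `Q_n` (`sylvesterForm_mem_heegnerForms`). [cite: Gross1984, §I.1] -/
private theorem isUnit_of_dvd_partner {p n : ℕ} (hp : p % 3 = 1) (hn : n ≠ 0)
    (hnC : IsCoprime (n : ℤ) (4 * (p : ℤ) ^ 2 + 18 * p + 81)) {a b c d : ℤ} (hdet : a * d - b * c = 243)
    {Q' : ℤ × ℤ × ℤ}
    (h₁ : 243 * Q'.1 = (compAdj a b c d ((n : ℤ) ^ 2 * (81 * ((p : ℤ) ^ 2 + 4 * p + 16)),
        (n : ℤ) * (-(9 * (4 * (p : ℤ) ^ 2 + 17 * p + 72))), 4 * (p : ℤ) ^ 2 + 18 * p + 81)).1)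
    (h₂ : 243 * Q'.2.1 = (compAdj a b c d ((n : ℤ) ^ 2 * (81 * ((p : ℤ) ^ 2 + 4 * p + 16)),
        (n : ℤ) * (-(9 * (4 * (p : ℤ) ^ 2 + 17 * p + 72))), 4 * (p : ℤ) ^ 2 + 18 * p + 81)).2.1)
    (h₃ : 243 * Q'.2.2 = (compAdj a b c d ((n : ℤ) ^ 2 * (81 * ((p : ℤ) ^ 2 + 4 * p + 16)),
        (n : ℤ) * (-(9 * (4 * (p : ℤ) ^ 2 + 17 * p + 72))), 4 * (p : ℤ) ^ 2 + 18 * p + 81)).2.2)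
    (h3C : ¬ (3 : ℤ) ∣ Q'.2.2) {e : ℤ} (he₁ : e ∣ Q'.1) (he₂ : e ∣ Q'.2.1) (he₃ : e ∣ Q'.2.2) : IsUnit e := by
  obtain ⟨-, -, -, hprim⟩ := sylvesterForm_mem_heegnerForms hp hn hnC
  by_contra he
  obtain ⟨q, hq, hqe⟩ := Int.exists_prime_and_dvd (fun h ↦ he (Int.isUnit_iff_natAbs_eq.mpr h))
  obtain ⟨hqA, hqB, hqC⟩ :=
    dvd_det_sq_mul_of_smul_eq_compAdj h₁ h₂ h₃ (hqe.trans he₁) (hqe.trans he₂) (hqe.trans he₃)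
  rw [hdet] at hqA hqB hqC
  -- `q` is not associated to `3`
  have hq3 : ¬ q ∣ 3 := fun h ↦
    h3C (((hq.associated_of_dvd Int.prime_three h).symm.dvd.trans hqe).trans he₃)
  have hq243 : ¬ q ∣ (243 : ℤ) ^ 2 := fun h ↦ by
    have h' : q ∣ (3 : ℤ) ^ 10 := by norm_num at h ⊢; exact h
    exact hq3 (hq.dvd_of_dvd_pow h')
  have hA := (hq.dvd_or_dvd hqA).resolve_left hq243
  have hB := (hq.dvd_or_dvd hqB).resolve_left hq243
  have hC := (hq.dvd_or_dvd hqC).resolve_left hq243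
  exact hq.not_unit (hprim q hA hB hC)

/-- The discriminant `(nB)² − 4·n²A·C = −243·(pn)²` of HSY's form of conductor `9pn` is negative (private helper; `p, n ≥ 1`).
[cite: HuShuYin2019, §4.1 (p. 10)] -/
theorem disc_sylvesterForm_neg {p n : ℕ} (hp0 : 0 < p) (hn : n ≠ 0) :
    ((n : ℤ) * (-(9 * (4 * (p : ℤ) ^ 2 + 17 * p + 72)))) ^ 2 -
        4 * ((n : ℤ) ^ 2 * (81 * ((p : ℤ) ^ 2 + 4 * p + 16))) * (4 * (p : ℤ) ^ 2 + 18 * p + 81) < 0 := by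
  have h : ((n : ℤ) * (-(9 * (4 * (p : ℤ) ^ 2 + 17 * p + 72)))) ^ 2 -
      4 * ((n : ℤ) ^ 2 * (81 * ((p : ℤ) ^ 2 + 4 * p + 16))) * (4 * (p : ℤ) ^ 2 + 18 * p + 81) =
      -(243 * ((p : ℤ) * n) ^ 2) := by ring
  rw [h]
  have hp0' : (0 : ℤ) < p := by exact_mod_cast hp0
  have hn0 : (0 : ℤ) < n := by exact_mod_cast Nat.pos_of_ne_zero hn
  nlinarith [mul_pos hp0' hn0]

/-- Membership transfer for the Sylvester tower (private helper): `243·Q′ = Q_n ∘ adj g`, `det g = 243`, `243 ∣ A′`, `3 ∤ C′`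
⟹ `Q′ ∈ heegnerForms 243 ((9pn)²·(−3))` (discriminant `sq_mul_disc_of_smul_eq_compAdj`, positivity
`compAdj_fst_pos_of_det_pos`, primitivity `isUnit_of_dvd_partner`). [cite: Gross1984, §I.1] -/
private theorem partner_mem_heegnerForms {p n : ℕ} (hp : p % 3 = 1) (hn : n ≠ 0)
    (hnC : IsCoprime (n : ℤ) (4 * (p : ℤ) ^ 2 + 18 * p + 81)) {a b c d : ℤ} (hdet : a * d - b * c = 243)
    {Q' : ℤ × ℤ × ℤ}
    (h₁ : 243 * Q'.1 = (compAdj a b c d ((n : ℤ) ^ 2 * (81 * ((p : ℤ) ^ 2 + 4 * p + 16)),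
        (n : ℤ) * (-(9 * (4 * (p : ℤ) ^ 2 + 17 * p + 72))), 4 * (p : ℤ) ^ 2 + 18 * p + 81)).1)
    (h₂ : 243 * Q'.2.1 = (compAdj a b c d ((n : ℤ) ^ 2 * (81 * ((p : ℤ) ^ 2 + 4 * p + 16)),
        (n : ℤ) * (-(9 * (4 * (p : ℤ) ^ 2 + 17 * p + 72))), 4 * (p : ℤ) ^ 2 + 18 * p + 81)).2.1)
    (h₃ : 243 * Q'.2.2 = (compAdj a b c d ((n : ℤ) ^ 2 * (81 * ((p : ℤ) ^ 2 + 4 * p + 16)),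
        (n : ℤ) * (-(9 * (4 * (p : ℤ) ^ 2 + 17 * p + 72))), 4 * (p : ℤ) ^ 2 + 18 * p + 81)).2.2)
    (h243 : (243 : ℤ) ∣ Q'.1) (h3C : ¬ (3 : ℤ) ∣ Q'.2.2) :
    Q' ∈ heegnerForms 243 (((9 * p * n : ℕ) : ℤ) ^ 2 * (-3)) := by
  have hp0 : 0 < p := by omega
  obtain ⟨hdisc, hA, -, -⟩ := sylvesterForm_mem_heegnerForms hp hn hnC
  have hneg := disc_sylvesterForm_neg hp0 hn
  have hdet0 : 0 < a * d - b * c := by rw [hdet]; norm_num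
  refine ⟨?_, ?_, h243, fun e he₁ he₂ he₃ ↦ isUnit_of_dvd_partner hp hn hnC hdet h₁ h₂ h₃ h3C he₁ he₂ he₃⟩
  · -- discriminant: `243²·disc Q′ = 243²·disc Q_n`
    have h := sq_mul_disc_of_smul_eq_compAdj h₁ h₂ h₃
    rw [hdet, hdisc] at h
    exact mul_left_cancel₀ (by norm_num : (243 : ℤ) ^ 2 ≠ 0) h
  · -- positivity: `243·A′ = (Q_n ∘ adj g).1 > 0`
    have h := compAdj_fst_pos_of_det_pos hA hneg hdet0
    rw [← h₁] at h
    exact pos_of_mul_pos_right h (by norm_num)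

/-- `3 ∤ C′` for `Q_n^{AW}`: `C′ = 784n²(P₁/3) − 84nP₂ + 27P₃ ≡ n²(P₁/3) (mod 3)` and `3 ∤ n`, `3 ∤ P₁/3`
(`three_not_dvd_sylvesterA_div`). [cite: HuShuYin2019, §4.1 (p. 10)] -/
theorem three_not_dvd_partnerAW_C {p n : ℕ} (hp : p % 3 = 1) (hn3 : ¬ 3 ∣ n) :
    ¬ (3 : ℤ) ∣ 784 * (n : ℤ) ^ 2 * (((p : ℤ) ^ 2 + 4 * p + 16) / 3) - 84 * n * (4 * (p : ℤ) ^ 2 + 17 * p + 72) +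
        27 * (4 * (p : ℤ) ^ 2 + 18 * p + 81) := by
  intro h
  have hX := three_not_dvd_sylvesterA_div hp hn3
  rw [(sylvesterA_div_eq hp (n : ℤ)).1] at hX
  apply hX
  have h' : (3 : ℤ) ∣ 783 * (n : ℤ) ^ 2 * (((p : ℤ) ^ 2 + 4 * p + 16) / 3) - 84 * n * (4 * (p : ℤ) ^ 2 + 17 * p + 72) +
      27 * (4 * (p : ℤ) ^ 2 + 18 * p + 81) :=
    ⟨261 * (n : ℤ) ^ 2 * (((p : ℤ) ^ 2 + 4 * p + 16) / 3) - 28 * n * (4 * (p : ℤ) ^ 2 + 17 * p + 72) +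
      9 * (4 * (p : ℤ) ^ 2 + 18 * p + 81), by ring⟩
  have h'' := dvd_sub h h'
  ring_nf at h'' ⊢
  exact h''

/-- `3 ∤ C′` for `Q_n^{A²W}`: `C′ = 657721n²(P₁/3) − 70557nP₂ + 22707P₃ ≡ n²(P₁/3) (mod 3)`.
[cite: HuShuYin2019, §4.1 (p. 10)] -/
theorem three_not_dvd_partnerAsqW_C {p n : ℕ} (hp : p % 3 = 1) (hn3 : ¬ 3 ∣ n) :
    ¬ (3 : ℤ) ∣ 657721 * (n : ℤ) ^ 2 * (((p : ℤ) ^ 2 + 4 * p + 16) / 3) - 70557 * n * (4 * (p : ℤ) ^ 2 + 17 * p + 72) +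
        22707 * (4 * (p : ℤ) ^ 2 + 18 * p + 81) := by
  intro h
  have hX := three_not_dvd_sylvesterA_div hp hn3
  rw [(sylvesterA_div_eq hp (n : ℤ)).1] at hX
  apply hX
  have h' : (3 : ℤ) ∣ 657720 * (n : ℤ) ^ 2 * (((p : ℤ) ^ 2 + 4 * p + 16) / 3) - 70557 * n * (4 * (p : ℤ) ^ 2 + 17 * p + 72) +
      22707 * (4 * (p : ℤ) ^ 2 + 18 * p + 81) :=
    ⟨219240 * (n : ℤ) ^ 2 * (((p : ℤ) ^ 2 + 4 * p + 16) / 3) - 23519 * n * (4 * (p : ℤ) ^ 2 + 17 * p + 72) +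
      7569 * (4 * (p : ℤ) ^ 2 + 18 * p + 81), by ring⟩
  have h'' := dvd_sub h h'
  ring_nf at h'' ⊢
  exact h''

/-- ★ **`Q_n^{AW}` is a level-`243` Heegner form of discriminant `(9pn)²·(−3)`** for `p ≡ 1 (mod 3)`, `n ≥ 1`, `3 ∤ n`,
`gcd(n, C) = 1` (the A-class twin of `fricke_sylvesterForm_mem_heegnerForms`).
[cite: HuShuYin2019, §2.1–2.2, §4.1 (p. 10)] [cite: Gross1984, §I.1] -/
theorem partnerAW_mem_heegnerForms {p n : ℕ} (hp : p % 3 = 1) (hn : n ≠ 0) (hn3 : ¬ 3 ∣ n)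
    (hnC : IsCoprime (n : ℤ) (4 * (p : ℤ) ^ 2 + 18 * p + 81)) :
    ((243 * (9 * (n : ℤ) ^ 2 * ((p : ℤ) ^ 2 + 4 * p + 16) - 3 * n * (4 * (p : ℤ) ^ 2 + 17 * p + 72) +
        (4 * (p : ℤ) ^ 2 + 18 * p + 81)),
      -(9 * (168 * (n : ℤ) ^ 2 * ((p : ℤ) ^ 2 + 4 * p + 16) - 55 * n * (4 * (p : ℤ) ^ 2 + 17 * p + 72) +
        18 * (4 * (p : ℤ) ^ 2 + 18 * p + 81))),
      784 * (n : ℤ) ^ 2 * (((p : ℤ) ^ 2 + 4 * p + 16) / 3) - 84 * n * (4 * (p : ℤ) ^ 2 + 17 * p + 72) +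
        27 * (4 * (p : ℤ) ^ 2 + 18 * p + 81)) : ℤ × ℤ × ℤ) ∈
      heegnerForms 243 (((9 * p * n : ℕ) : ℤ) ^ 2 * (-3)) := by
  obtain ⟨h₁, h₂, h₃⟩ := smul_partnerAW_eq_compAdj hp n
  exact partner_mem_heegnerForms hp hn hnC (by norm_num) h₁ h₂ h₃ (Dvd.intro _ rfl)
    (three_not_dvd_partnerAW_C hp hn3)

/-- ★ **`Q_n^{A²W}` is a level-`243` Heegner form of discriminant `(9pn)²·(−3)`** for `p ≡ 1 (mod 3)`, `n ≥ 1`, `3 ∤ n`,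
`gcd(n, C) = 1`. [cite: HuShuYin2019, §2.1–2.2, §4.1 (p. 10)] [cite: Gross1984, §I.1] -/
theorem partnerAsqW_mem_heegnerForms {p n : ℕ} (hp : p % 3 = 1) (hn : n ≠ 0) (hn3 : ¬ 3 ∣ n)
    (hnC : IsCoprime (n : ℤ) (4 * (p : ℤ) ^ 2 + 18 * p + 81)) :
    ((243 * (7569 * (n : ℤ) ^ 2 * ((p : ℤ) ^ 2 + 4 * p + 16) - 2436 * n * (4 * (p : ℤ) ^ 2 + 17 * p + 72) +
        784 * (4 * (p : ℤ) ^ 2 + 18 * p + 81)),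
      -(9 * (141114 * (n : ℤ) ^ 2 * ((p : ℤ) ^ 2 + 4 * p + 16) - 45415 * n * (4 * (p : ℤ) ^ 2 + 17 * p + 72) +
        14616 * (4 * (p : ℤ) ^ 2 + 18 * p + 81))),
      657721 * (n : ℤ) ^ 2 * (((p : ℤ) ^ 2 + 4 * p + 16) / 3) - 70557 * n * (4 * (p : ℤ) ^ 2 + 17 * p + 72) +
        22707 * (4 * (p : ℤ) ^ 2 + 18 * p + 81)) : ℤ × ℤ × ℤ) ∈
      heegnerForms 243 (((9 * p * n : ℕ) : ℤ) ^ 2 * (-3)) := by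
  obtain ⟨h₁, h₂, h₃⟩ := smul_partnerAsqW_eq_compAdj hp n
  exact partner_mem_heegnerForms hp hn hnC (by norm_num) h₁ h₂ h₃ (Dvd.intro _ rfl)
    (three_not_dvd_partnerAsqW_C hp hn3)

end Summit.BirchSwinnertonDyer.BirchSwinnertonDyer.Theorems.SylvesterTwoLevelFixingOrbitA

end
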